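import Literature.Analysis.Matrix.GramSchmidtNearIdentity
import Literature.Analysis.Matrix.GramSchmidtIntegerColumns
import HarnessLib

/-!
# A nearly orthogonal family is linearly independent

Topic `Analysis/Matrix`, a complement to `GramSchmidtNearIdentity.lean` (`NearOrthogonal f N t`:
`|⟪bᵢ, bⱼ⟫ - N δᵢⱼ| ≤ t N`). The exact Gram–Schmidt rounding of the reduction machine of
Aaronson–Arkhipov's Thm. 1.3 (`GramSchmidtRounding.roundedGS_rowsOf`) is stated for a matrix with
`ℂ`-independent columns; the analysis supplies near-orthogonality of the Gram matrix. This file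
closes the gap by the diagonal-dominance argument:

* `linearIndependent_of_nearOrthogonal` — `NearOrthogonal f N t`, `N > 0`, `t n < 1` ⟹ `f` is
  linearly independent (a relation `∑ aᵢ bᵢ = 0` paired with `bⱼ` at a coefficient of maximal
  modulus gives `|aⱼ| (1 - t) N ≤ (n - 1) t N |aⱼ|`);
* `linearIndependent_colVec_of_gram` — the matrix form, from the Gram matrix `Bᴴ B`;
* `linearIndependent_colVec_gaussIntMatrix_of_gram` — the same for `gaussIntMatrix B`, the
  hypothesis of `roundedGS_rowsOf`.

All proved.

## References

* R. A. Horn, C. R. Johnson, *Matrix Analysis*, 2nd ed., CUP 2013, Thm. 6.1.10 (strictly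
  diagonally dominant matrices are nonsingular; Levy–Desplanques). (Standard; proved here in the
  form needed.)
-/

noncomputable section

namespace Literature.Analysis.Matrix

open Finset InnerProductSpace
open scoped _root_.Matrix ComplexConjugate

section General

variable {E : Type*} [NormedAddCommGroup E] [InnerProductSpace ℂ E] {n : ℕ}

/-- **A nearly orthogonal family is linearly independent** (`t n < 1`). [cite: HornJohnson2013, Thm. 6.1.10] -/
theorem linearIndependent_of_nearOrthogonal {f : Fin n → E} {N t : ℝ} (hG : NearOrthogonal f N t)
    (hN : 0 < N) (htn : t * n < 1) : LinearIndependent ℂ f := by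
  classical
  rw [Fintype.linearIndependent_iff]
  intro a ha
  -- trivial if `n = 0`
  rcases Nat.eq_zero_or_pos n with hn | hn
  · subst hn; intro i; exact Fin.elim0 i
  haveI : Nonempty (Fin n) := ⟨⟨0, hn⟩⟩
  have ht0 : 0 ≤ t := by
    have h := hG ⟨0, hn⟩ ⟨0, hn⟩
    have : 0 ≤ t * N := le_trans (norm_nonneg _) h
    nlinarith
  -- a coefficient of maximal modulus
  obtain ⟨j, hj⟩ := Finite.exists_max fun i => ‖a i‖
  -- pair the relation with `f j`
  have hrel : ∑ i, a i * inner ℂ (f j) (f i) = 0 := by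
    have := congrArg (fun v => inner ℂ (f j) v) ha
    simpa [inner_sum, inner_smul_right] using this
  -- isolate the diagonal term
  rw [← Finset.add_sum_erase _ _ (mem_univ j)] at hrel
  have hdiag : ‖a j‖ * ((1 - t) * N) ≤ ‖a j * inner ℂ (f j) (f j)‖ := by
    rw [norm_mul]
    refine mul_le_mul_of_nonneg_left ?_ (norm_nonneg _)
    have h := hG j j
    rw [if_pos rfl] at h
    -- `‖⟪f j, f j⟫‖ ≥ N - tN`
    have := norm_sub_norm_le (N : ℂ) (inner ℂ (f j) (f j))
    rw [← norm_neg ((N : ℂ) - _), neg_sub] at this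
    have hNn : ‖(N : ℂ)‖ = N := by rw [Complex.norm_real, Real.norm_of_nonneg hN.le]
    linarith
  have hoff : ‖a j * inner ℂ (f j) (f j)‖ ≤ (univ.erase j).card * (‖a j‖ * (t * N)) := by
    have heq : a j * inner ℂ (f j) (f j) = -∑ i ∈ univ.erase j, a i * inner ℂ (f j) (f i) := by
      linear_combination hrel
    rw [heq, norm_neg]
    refine (norm_sum_le _ _).trans ?_
    have hterm : ∀ i ∈ univ.erase j, ‖a i * inner ℂ (f j) (f i)‖ ≤ ‖a j‖ * (t * N) := by
      intro i hi
      rw [norm_mul]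
      refine mul_le_mul (hj i) ?_ (norm_nonneg _) (norm_nonneg _)
      have h := hG j i
      rwa [if_neg (ne_of_mem_erase hi).symm, sub_zero] at h
    calc ∑ i ∈ univ.erase j, ‖a i * inner ℂ (f j) (f i)‖ ≤ ∑ _i ∈ univ.erase j, ‖a j‖ * (t * N) :=
          Finset.sum_le_sum hterm
      _ = (univ.erase j).card * (‖a j‖ * (t * N)) := by rw [Finset.sum_const, nsmul_eq_mul]
  have hcard : ((univ.erase j).card : ℝ) ≤ n - 1 := by
    rw [Finset.card_erase_of_mem (mem_univ j), Finset.card_univ, Fintype.card_fin, Nat.cast_sub hn]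
    simp
  -- `‖a j‖ = 0`
  have hj0 : ‖a j‖ = 0 := by
    by_contra h0
    have hpos : 0 < ‖a j‖ := lt_of_le_of_ne (norm_nonneg _) (Ne.symm h0)
    have h1 : ‖a j‖ * ((1 - t) * N) ≤ (n - 1) * (‖a j‖ * (t * N)) :=
      hdiag.trans (hoff.trans (mul_le_mul_of_nonneg_right hcard (by positivity)))
    -- divide by `‖a j‖ N > 0`: `1 - t ≤ (n - 1) t`, i.e. `1 ≤ n t`, contradiction
    have h2 : (1 - t) ≤ (n - 1) * t := by
      have := h1
      have hajN : 0 < ‖a j‖ * N := mul_pos hpos hN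
      nlinarith
    nlinarith
  intro i
  have : ‖a i‖ = 0 := le_antisymm ((hj i).trans hj0.le) (norm_nonneg _)
  exact norm_eq_zero.1 this

end General

section Matrices

variable {m n : ℕ}

/-- The matrix form: near-orthogonality of the Gram matrix `Bᴴ B` (`t n < 1`, `N > 0`) makes the
columns of `B` independent. [cite: HornJohnson2013, Thm. 6.1.10] -/
theorem linearIndependent_colVec_of_gram {B : _root_.Matrix (Fin m) (Fin n) ℂ} {N t : ℝ}
    (hG : ∀ i j, ‖(Bᴴ * B) i j - (if i = j then (N : ℂ) else 0)‖ ≤ t * N) (hN : 0 < N) (htn : t * n < 1) :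
    LinearIndependent ℂ (colVec B) :=
  linearIndependent_of_nearOrthogonal (nearOrthogonal_colVec hG) hN htn

/-- The same for a Gaussian-integer matrix (the hypothesis of `roundedGS_rowsOf`). [folklore] -/
theorem linearIndependent_colVec_gaussIntMatrix_of_gram {B : _root_.Matrix (Fin m) (Fin n) (ℤ × ℤ)} {N t : ℝ}
    (hG : ∀ i j, ‖((gaussIntMatrix B)ᴴ * gaussIntMatrix B) i j - (if i = j then (N : ℂ) else 0)‖ ≤ t * N)
    (hN : 0 < N) (htn : t * n < 1) : LinearIndependent ℂ (colVec (gaussIntMatrix B)) :=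
  linearIndependent_colVec_of_gram hG hN htn

end Matrices

end Literature.Analysis.Matrix
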